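import Mathlib
import Literature.Computability.Complexity.Mod2SymmetricPseudoexpectationInterpolation
import HarnessLib

/-!
# The symmetric pseudo-matching functional — Part D: Theorem 1.2 for a clique `K_U` inside `[n]`

A bookkeeping supplement to `Mod2SymmetricPseudoexpectationInterpolation.lean` (Part C, which proves
Potechin's Theorem 1.2 [Potechin2019] in the range `6k ≤ N`: `storyForm_nonneg`,
`pseudoMatching_momentForm_nonneg`).  Downstream (tracial / level-weight estimates for perfect matching)
the pseudo-expectation is used on the clique spanned by an odd vertex subset `U ⊆ [n]` of an ambient
`K_n`, with coefficient vectors indexed by edge sets of `K_n` of size `≤ k` and the kernel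
`[A ∪ A' partial matching inside U] · (∏_{j<|A ∪ A'|} (|U| − 1 − 2j))⁻¹`.  This file transports the
theorem along the vertex embedding `Fin |U| ↪ Fin n` onto `U` (`cliqueEmb`, via `Finset.equivFin`):
rows and columns indexed by edge sets not inside `U` vanish, and on edge sets inside `U` the kernel is
the story kernel of `K_{|U|}` pulled back (`push` of Part C is injective and preserves unions, sizes and
partial matchings).

## Contents (all proved; no named facts)

* `cliqueEmb`, `cliqueEmb_mem`, `cliqueEmb_equivFin`, `exists_push_cliqueEmb_eq`, `push_cliqueEmb_inner`;
  `isPartialMatching_iff_exists_mem_PM` (even `m`: partial matching ↔ contained in a perfect matching).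
* **`pseudoMatching_momentForm_nonneg_on`**: for `U ⊆ [n]`, `|U|` odd, `6k ≤ |U|` and every
  `δ : {F : Finset (Sym2 (Fin n)) // |F| ≤ k} → ℝ`,
  `0 ≤ Σ_{A,A'} δ_A δ_{A'} [A ∪ A' p.m. ∧ A ∪ A' ⊆ E(U)] (∏_{j<|A∪A'|} (|U| − 1 − 2j))⁻¹`
  (the `if` is stated with the classical decidability instance `Classical.dec _`; rewrite with
  `if_pos`/`if_neg` or `convert`).

## References

* A. Potechin, *Sum of squares lower bounds from symmetry and a good story*, ITCS 2019, LIPIcs 124:61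
  (arXiv:1711.11469), Theorem 1.2. [Potechin2019]
-/

noncomputable section

open Finset Matrix
open scoped BigOperators

namespace Literature.Computability.Complexity

namespace PseudoMatching

open Literature.Combinatorics.Optimization (innerEdges mem_innerEdges)

/-! ### §C9 Transport: the theorem for a clique `K_U` on a vertex subset `U ⊆ [n]` -/

variable {n : ℕ}

/-- The vertex embedding `Fin |U| ↪ Fin n` onto `U ⊆ [n]` (through `Finset.equivFin`), used to transport
Theorem 1.2 from `K_{|U|}` to the clique on `U` inside a larger vertex set.
[cite: Potechin2019, Theorem 1.2 (61:4)] -/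
def cliqueEmb (U : Finset (Fin n)) : Fin U.card ↪ Fin n :=
  U.equivFin.symm.toEmbedding.trans (Function.Embedding.subtype _)

/-- `cliqueEmb U` lands in `U`. [cite: Potechin2019, Theorem 1.2 (61:4)] -/
theorem cliqueEmb_mem (U : Finset (Fin n)) (i : Fin U.card) : cliqueEmb U i ∈ U :=
  (U.equivFin.symm i).2

/-- `cliqueEmb U` inverts `U.equivFin`. [cite: Potechin2019, Theorem 1.2 (61:4)] -/
theorem cliqueEmb_equivFin (U : Finset (Fin n)) {x : Fin n} (hx : x ∈ U) :
    cliqueEmb U (U.equivFin ⟨x, hx⟩) = x := by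
  simp [cliqueEmb]

/-- Every edge set inside `U` is the transport of an edge set of `K_{|U|}`.
[cite: Potechin2019, Theorem 1.2 (61:4)] -/
theorem exists_push_cliqueEmb_eq (U : Finset (Fin n)) {B : Finset (Sym2 (Fin n))}
    (hB : ∀ e ∈ B, ∀ x ∈ e, x ∈ U) : ∃ G : Finset (Sym2 (Fin U.card)), push (cliqueEmb U) G = B := by
  classical
  have hrange : ∀ z ∈ B, ∃ z', Sym2.map (cliqueEmb U) z' = z := by
    intro z hz
    induction z using Sym2.ind with
    | h x y =>
      refine ⟨s(U.equivFin ⟨x, hB _ hz x (Sym2.mem_mk_left x y)⟩,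
        U.equivFin ⟨y, hB _ hz y (Sym2.mem_mk_right x y)⟩), ?_⟩
      rw [Sym2.map_mk, cliqueEmb_equivFin, cliqueEmb_equivFin]
  refine ⟨B.preimage (Sym2.map (cliqueEmb U)) (Sym2.map.injective (cliqueEmb U).injective).injOn, ?_⟩
  ext z
  simp only [mem_push, mem_preimage]
  constructor
  · rintro ⟨z', hz', rfl⟩; exact hz'
  · intro hz
    obtain ⟨z', rfl⟩ := hrange z hz
    exact ⟨z', hz, rfl⟩

/-- Transported edge sets lie inside `U`. [cite: Potechin2019, Theorem 1.2 (61:4)] -/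
theorem push_cliqueEmb_inner (U : Finset (Fin n)) (G : Finset (Sym2 (Fin U.card))) :
    ∀ e ∈ push (cliqueEmb U) G, ∀ x ∈ e, x ∈ U := by
  intro e he x hx
  obtain ⟨z', _, rfl⟩ := mem_push.1 he
  obtain ⟨y, _, rfl⟩ := Sym2.mem_map.1 hx
  exact cliqueEmb_mem U y

/-- In `K_m` with `m` even, an edge set is a partial matching iff it is contained in a perfect matching
(used downstream to match the kernel's support condition "`A ∪ A'` extends to a perfect matching").
[cite: Potechin2019, Cor. 3.10 (61:9, even `n`: uniform distribution over perfect matchings)] -/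
theorem isPartialMatching_iff_exists_mem_PM {m : ℕ} (hm : Even m) {G : Finset (Sym2 (Fin m))} :
    IsPartialMatching G ↔ ∃ M ∈ PM m, G ⊆ M := by
  classical
  refine ⟨fun hG => ?_, fun ⟨M, hM, hGM⟩ => (isPartialMatching_of_mem_PM hM).subset hGM⟩
  have h2 : 2 * G.card ≤ m := by
    have h := card_le_univ (verts G)
    rw [hG.card_verts, Fintype.card_fin] at h
    exact h
  have hpos : 0 < (pmCount G : ℝ) := by
    rw [← storyValue_mul_card_PM, storyValue_of hG]
    exact mul_pos (moment_pos h2) (by exact_mod_cast card_PM_pos hm)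
  have hne : ((PM m).filter fun M => G ⊆ M).Nonempty := by
    rw [← card_pos]
    exact_mod_cast hpos
  obtain ⟨M, hM⟩ := hne
  exact ⟨M, (mem_filter.1 hM).1, (mem_filter.1 hM).2⟩

/-- **Theorem 1.2 on a clique `K_U` inside `[n]`** (the shape used downstream, with coefficient vectors
indexed by edge sets of `K_n` of size `≤ k` and the kernel supported on partial matchings inside `U`):
for `U ⊆ [n]` with `|U|` odd and `6k ≤ |U|`,
`0 ≤ Σ_{A,A'} δ_A δ_{A'} · [A ∪ A' p.m., A ∪ A' ⊆ E(U)] · (∏_{j<|A ∪ A'|} (|U| − 1 − 2j))⁻¹`.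
[cite: Potechin2019, Theorem 1.2 (61:4)] -/
theorem pseudoMatching_momentForm_nonneg_on (U : Finset (Fin n)) (hU : Odd U.card) {k : ℕ}
    (hk : 6 * k ≤ U.card) (δ : {F : Finset (Sym2 (Fin n)) // F.card ≤ k} → ℝ) :
    0 ≤ ∑ A, ∑ A', δ A * δ A' *
      @ite ℝ (IsPartialMatching (A.1 ∪ A'.1) ∧ ∀ e ∈ A.1 ∪ A'.1, ∀ x ∈ e, x ∈ U) (Classical.dec _)
        (∏ j ∈ range (A.1 ∪ A'.1).card, ((U.card : ℝ) - 1 - 2 * j))⁻¹ 0 := by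
  classical
  set K : EdgeSets n k → EdgeSets n k → ℝ := fun A A' =>
    @ite ℝ (IsPartialMatching (A.1 ∪ A'.1) ∧ ∀ e ∈ A.1 ∪ A'.1, ∀ x ∈ e, x ∈ U) (Classical.dec _)
      (∏ j ∈ range (A.1 ∪ A'.1).card, ((U.card : ℝ) - 1 - 2 * j))⁻¹ 0 with hK
  change (0 : ℝ) ≤ ∑ A, ∑ A', δ A * δ A' * K A A'
  set Φ : EdgeSets U.card k → EdgeSets n k :=
    fun G => ⟨push (cliqueEmb U) G.1, by rw [card_push]; exact G.2⟩ with hΦ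
  have hΦval : ∀ G : EdgeSets U.card k, (Φ G).1 = push (cliqueEmb U) G.1 := fun G => rfl
  have hΦinj : Function.Injective Φ := fun G G' h =>
    Subtype.ext (push_injective (cliqueEmb U) (by rw [← hΦval, ← hΦval, h]))
  -- rows and columns off the image of `Φ` vanish
  have hgood : ∀ A : EdgeSets n k, A ∉ univ.image Φ → ∀ A', K A A' = 0 ∧ K A' A = 0 := by
    intro A hA A'
    have hnot : ¬ ∀ e ∈ A.1, ∀ x ∈ e, x ∈ U := by
      intro h
      obtain ⟨G, hG⟩ := exists_push_cliqueEmb_eq U h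
      refine hA (mem_image.2 ⟨⟨G, ?_⟩, mem_univ _, Subtype.ext hG⟩)
      rw [← card_push (cliqueEmb U) G, hG]; exact A.2
    constructor
    · exact if_neg fun h => hnot fun e he => h.2 e (mem_union_left _ he)
    · exact if_neg fun h => hnot fun e he => h.2 e (mem_union_right _ he)
  -- on the image the kernel is the story value of `K_{|U|}`
  have hKΦ : ∀ G G' : EdgeSets U.card k, K (Φ G) (Φ G') = storyValue U.card (G.1 ∪ G'.1) := by
    intro G G'
    show @ite ℝ (IsPartialMatching ((Φ G).1 ∪ (Φ G').1) ∧ ∀ e ∈ (Φ G).1 ∪ (Φ G').1, ∀ x ∈ e, x ∈ U)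
      (Classical.dec _) (∏ j ∈ range ((Φ G).1 ∪ (Φ G').1).card, ((U.card : ℝ) - 1 - 2 * j))⁻¹ 0 = _
    rw [hΦval, hΦval, ← push_union]
    by_cases hpm : IsPartialMatching (G.1 ∪ G'.1)
    · rw [if_pos ⟨isPartialMatching_push.2 hpm, push_cliqueEmb_inner U _⟩, card_push, storyValue_of hpm,
        moment_eq_inv_prod]
    · rw [if_neg fun h => hpm (isPartialMatching_push.1 h.1), storyValue_of_not hpm]
  calc (0 : ℝ) ≤ storyForm U.card k (fun G => δ (Φ G)) := storyForm_nonneg hU hk _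
    _ = ∑ G, ∑ G', δ (Φ G) * δ (Φ G') * K (Φ G) (Φ G') := by
        unfold storyForm
        simp only [hKΦ]
    _ = ∑ A, ∑ A', δ A * δ A' * K A A' := by
        symm
        rw [← sum_subset (subset_univ (univ.image Φ)) (fun A _ hA => ?_),
          sum_image fun G _ G' _ h => hΦinj h]
        · refine sum_congr rfl fun G _ => ?_
          rw [← sum_subset (subset_univ (univ.image Φ)) (fun A' _ hA' => ?_),
            sum_image fun G _ G' _ h => hΦinj h]
          rw [(hgood _ hA' (Φ G)).2, mul_zero]
        · exact sum_eq_zero fun A' _ => by rw [(hgood A hA A').1, mul_zero]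

end PseudoMatching

end Literature.Computability.Complexity
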